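import Literature.NumberTheory.EllipticCurves.DegreeConjectureAbcPrelims
import Literature.NumberTheory.EllipticCurves.NewformPeterssonSize
import Literature.NumberTheory.EllipticCurves.SilvermanHeightCovolume
import HarnessLib

/-!
# The modular degree conjecture for Frey curves implies the abc conjecture (Frey; Mai–Murty; Murty)

Topic `Literature/NumberTheory/EllipticCurves` (family `abc`). Requested by route
`ABC/DefiniteXi`, frame item `DegreeBoundToABC` (`stmt-ABC-2025`, "Frame X → ABC; a known theorem
modulo named facts to be vendored"), work item `wi-09451`; the same reduction is the assembly of
routes `ABC/QuaternionicDegree`, `ABC/IsogenyGlueCongruence` and (with an extra Tamagawa factor)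
`ABC/RibetTakahashiSplit`. Theorems only — NO new named fact: of the three requested ingredients,
(i) `2h(E) = log deg φ − log(4π²‖f‖²) + 2 log|c|` is Zagier's identity, PROVED in the tree
(`ModularParametrizationData.zagier_degree_formula_holds`; `c ∈ ℤ ∖ {0}`,
`maninConstant_ne_zero_holds` — no bound on the Manin constant is needed in this direction, since
`c² ≥ 1` only helps); (ii) `‖f_E‖² ≫_ε N^{1−ε}` is the named fact
`murty_petersson_newform_lower_bound` (`NewformPeterssonSize.lean`; Hoffstein–Lockhart 1994 with
the Goldfeld–Hoffstein–Lieman appendix, as used by Murty 1999); (iii)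
`12 h(E) ≥ log max(|Δ_min|, |c₄|³) − O(log(1 + h))` is the named fact
`silverman1986_discriminant_c4_covolume` (`SilvermanHeightCovolume.lean`; Silverman 1986,
Cor. 2.3 with Prop. 1.1, covolume form). Relative to (ii) and (iii) the implication is proved here.

## The statement proved

`abcLe_of_freyDegreeBound`: assume (ii), (iii) and

> for every `ε > 0` there is `C` such that for all coprime integers `a, b` with `ab(a+b) ≠ 0`,
> at level `N = N_E` the Frey curve `E_{a,b} : y² = x(x − a)(x + b)` (`freyCurve a b`) admits a
> modular parametrisation datum `D` (`ModularParametrizationData`, `ModularCurve.lean`: newform,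
> Néron-type lattice of this model, integral Manin constant `c`, degree `deg`) with
> `deg ≤ C · c² · N^{2+ε}`;

then the strong abc-conjecture holds in the printed `≤`-form of Bombieri–Gubler, Conj. 12.2.2:
`∀ ε > 0 ∃ C ∀` abc triples, `c ≤ C · rad(abc)^{1+ε}` (over Wave0's `IsABCTriple` / `rad`, exactly
the hypothesis form of `abcLe_iff_generalizedSzpiroBG` and the conclusion of the proved
`abcLe_of_generalizedSzpiroBG`). `abcLe_of_freyDegreeBound'` is the specialisation to the degree
bound `deg ≤ C N^{2+ε}` — literally the antecedent `FreyDegreeBound` of route `ABC/DefiniteXi` —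
using `c² ≥ 1`. The quotient `deg/c² = 4π²(f,f)/covol(Λ)` does not depend on the datum (Zagier),
which is why the `c²`-form is the natural hypothesis (it is the form `SemistableDegreeConjecture` of
route `ABC/QuaternionicDegree`, restricted to Frey curves).

Sources. Murty 1999, Thm. 1: "the abc conjecture is equivalent to the modular degree conjecture
for Frey–Hellegouarch curves" (statement as reported by Pasten, Rem. 3.3, who also notes that the
gap he fills concerns only the converse direction abc ⟹ degree conjecture, through the Manin
constant); the direction proved here is Frey's argument (Frey 1989; Frey 1997 §3, Lemma 3.1,
Prop. 3.1 (i), Cor. 3.1: with the trivial bound `‖f‖² ≥ e^{−4π}/4π` one gets abc with the exponent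
of the degree bound, i.e. `2 + ε`) sharpened by the Petersson lower bound `2 log‖f‖ ∼ log N`
(Murty 1999; Mai–Murty 1994), which recovers the exponent `1 + ε` (Pasten §3, (3.1)–(3.2) and the
remark after (3.2)).

## Proof

Fix `ε`, put `δ = min(1, ε/3)`. For an abc triple `(a, b, c)`:
* if `16 ∤ abc`, the equation (12.17) `y² = x³ + (b − a)x² − abx` (`freyIntModel a b`, `= freyCurve
  a b` over `ℚ`) is a global minimal equation (`isMinimalAt_freyIntModel`), `u = 1`;
* if `16 ∣ abc`, Serre's arrangement `(A, B)` of `{±a, ±b, ±c}` (`exists_arrangement`: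
  `A ≡ −1 (4)`, `16 ∣ B`, `|AB(A+B)| = abc`, `2(A² + AB + B²) = a² + b² + c²`) has the global
  minimal equation (12.18) (`freyIntModel₂ A B`, `isMinimalAt_freyIntModel₂`), reached from
  `freyCurve A B` by `(u, r, s, t) = (2, 0, 1, 0)` (`smul_freyCurve_eq_baseChange_freyIntModel₂`).
In both cases the hypothesis gives a datum `D` on the Frey model at level `N = N_E`, and
`estimates_of_frey_pair` (preliminaries file) yields `covol(Λ_D) ≥ κ N^{−(1+2δ)}` (Zagier +
Petersson), `covol(Λ_Néron) = u² covol(Λ_D) ≥ covol(Λ_D)` and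
`|c₄(W₀)|³ ≤ A covol(Λ_Néron)^{−(6+δ)}` (Silverman); with `c² ≤ 2|c₄(W₀)|`
(`c₄ = 16(a² + ab + b²)` resp. `(a² + b² + c²)/2`) and `N ≤ 2¹⁰ rad(abc)`
(`conductorNorm_freyIntModel_dvd`, `conductorNorm_freyIntModel₂_dvd`, conductor invariance
`conductor_smul`) this gives `c⁶ ≤ M_ε rad(abc)^{(1+2δ)(6+δ)} ≤ M_ε rad(abc)^{6(1+ε)}`.

## References

* M. R. Murty, *Bounds for congruence primes*, in: Automorphic Forms, Automorphic Representations,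
  and Arithmetic, Proc. Sympos. Pure Math. 66.1, AMS (1999) 177–192, Thm. 1.
  [MurtyCongruencePrimes1999] (not held — acquisition request acq-02076; statement of Thm. 1 as
  reported by [PastenShimura2024], Rem. 3.3.)
* H. Pasten, *Shimura curves and the abc conjecture*, J. Number Theory 254 (2024) =
  arXiv:1705.09251, §3, pp. 13–14 (read). [PastenShimura2024]
* G. Frey, *On ternary equations of Fermat type and relations with elliptic curves*, in Cornell–
  Silverman–Stevens (eds.), Modular Forms and Fermat's Last Theorem (1997) 527–548, §3 (read:
  Lemma 3.1, Prop. 3.1, Cor. 3.1). [Frey1997Ternary]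
* G. Frey, *Links between solutions of A − B = C and elliptic curves*, LNM 1380 (1989) 31–62.
  [Frey1989]
* J. Hoffstein, P. Lockhart, *Coefficients of Maass forms and the Siegel zero*, Ann. of Math. 140
  (1994). [HoffsteinLockhart1994]
* J. H. Silverman, *Heights and elliptic curves*, in: Arithmetic Geometry (1986), Cor. 2.3,
  Prop. 3.1 (read). [Silverman1986]
* E. Bombieri, W. Gubler, *Heights in Diophantine Geometry* (2006), Conj. 12.2.2, Ex. 12.5.10.
  [BombieriGubler2006]
-/

noncomputable section

open IsDedekindDomain WeierstrassCurve NumberField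

namespace Literature.NumberTheory.EllipticCurves

/-! ### The theorem -/

section Main

open ModularForms CongruenceSubgroup UniqueFactorizationMonoid

/-- **The modular degree conjecture for Frey curves implies the abc conjecture** (Frey 1987/1989;
Mai–Murty 1994; M. R. Murty, *Bounds for congruence primes* (1999), Thm. 1, direction "degree
conjecture ⟹ abc", as reviewed by Pasten, arXiv:1705.09251, §3 and Remark 3.3; Frey 1997,
Cor. 3.1 for the version with a general exponent). Relative to the two analytic named facts of the
tree — the Petersson lower bound `(f,f) ≫_ε N^{1−ε}` for the newform of an elliptic curve
(`murty_petersson_newform_lower_bound`, Hoffstein–Lockhart 1994 / Murty 1999) and Silverman's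
`max(|Δ_min|, |c₄|³) ≪_ε covol(Λ_Néron)^{−6−ε}` (`silverman1986_discriminant_c4_covolume`,
Silverman 1986, Cor. 2.3 with Prop. 1.1) — the following is PROVED: if for every `ε > 0` there is
`C` such that for all coprime `a, b` with `ab(a+b) ≠ 0` the Frey curve `E_{a,b} : y² = x(x−a)(x+b)`
admits at level `N = N_E` a modular parametrisation datum with `deg ≤ C · c² · N^{2+ε}` (`c` its
Manin constant; in particular if `deg ≤ C N^{2+ε}`, since `c ∈ ℤ ∖ {0}`), then the strong
abc-conjecture holds in the `≤`-form of Bombieri–Gubler 12.2.2: `c ≤ C_ε rad(abc)^{1+ε}` for every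
abc triple. Proof: Zagier's identity `4π²c²(f,f) = deg · covol(Λ)` (proved,
`zagier_degree_formula_holds`) and the two bounds give `covol(Λ) ≥ κ_ε N^{−1−2ε}` for the
lattice of the Frey model; the Néron lattice of its global minimal equation ((12.17), or (12.18)
after Serre's normalisation, `exists_arrangement`; `u ∈ {1, 2}`) has covolume `u² covol(Λ)`, so
Silverman gives `|c₄|³ ≪ N^{(1+2ε)(6+ε)}` while `c² ≤ 2|c₄|` and `N ≤ 2¹⁰ rad(abc)`.
[cite: MurtyCongruencePrimes1999, Thm. 1 (degree conjecture implies abc) via PastenShimura2024 §3 Rem. 3.3] -/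
theorem abcLe_of_freyDegreeBound
    (hP : murty_petersson_newform_lower_bound)
    (hS : silverman1986_discriminant_c4_covolume)
    (hdeg : ∀ ε : ℝ, 0 < ε → ∃ C : ℝ, ∀ a b : ℤ, IsCoprime a b → a * b * (a + b) ≠ 0 →
      ∀ (N : ℕ) [NeZero N], (freyCurve a b).conductorNorm ℤ = N →
        ∃ D : ModularParametrizationData (freyCurve a b) N,
          (D.deg : ℝ) ≤ C * (D.c : ℝ) ^ 2 * (N : ℝ) ^ (2 + ε)) :
    ∀ ε : ℝ, 0 < ε → ∃ C : ℝ, ∀ a b c : ℕ, DiophantineGeometry.IsABCTriple a b c →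
      (c : ℝ) ≤ C * ((DiophantineGeometry.rad a b c : ℕ) : ℝ) ^ (1 + ε) := by
  intro ε hε
  -- parameters and constants, depending on `ε` only
  set δ : ℝ := min 1 (ε / 3) with hδdef
  have hδ : 0 < δ := lt_min one_pos (by positivity)
  have hδ1 : δ ≤ 1 := min_le_left _ _
  have hδε : 3 * δ ≤ ε := by have := min_le_right 1 (ε / 3); linarith
  obtain ⟨C₀, hC₀⟩ := hdeg δ hδ
  obtain ⟨c₂, hc₂, hPc⟩ := hP δ hδ
  obtain ⟨A₀, hA₀⟩ := hS δ hδ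
  have hA : (0 : ℝ) ≤ max A₀ 1 := zero_le_one.trans (le_max_right _ _)
  set κ : ℝ := 4 * Real.pi ^ 2 * c₂ / max C₀ 1 with hκdef
  have hκ : 0 < κ := div_pos (by positivity) (one_pos.trans_le (le_max_right _ _))
  set M : ℝ := 8 * max A₀ 1 * κ ^ (-(6 + δ)) * (2 ^ 10) ^ ((1 + 2 * δ) * (6 + δ)) with hMdef
  have hM : 0 ≤ M := by positivity
  refine ⟨M ^ (1 / 6 : ℝ), fun a b c h ↦ ?_⟩
  have h' := h
  obtain ⟨ha, hb, habc, hcop⟩ := h'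
  have hc0 : 0 < c := by omega
  have habc0 : a * b * c ≠ 0 := by positivity
  set R : ℝ := ((DiophantineGeometry.rad a b c : ℕ) : ℝ) with hRdef
  have hRpos : 0 < DiophantineGeometry.rad a b c := by
    rw [DiophantineGeometry.rad_def]; exact Nat.pos_of_ne_zero radical_ne_zero
  have hR : (1 : ℝ) ≤ R := by rw [hRdef]; exact_mod_cast hRpos
  -- the estimates: `∃ cov cov' N c4, …`
  obtain ⟨cov, cov', Nr, c4, hcovpos, hcc4, hc₄, hcc, hlow, hNpos, hNR⟩ :
      ∃ cov cov' Nr c4 : ℝ, 0 < cov ∧ (c : ℝ) ^ 2 ≤ 2 * c4 ∧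
        c4 ^ 3 ≤ max A₀ 1 * cov' ^ (-(6 + δ)) ∧ cov ≤ cov' ∧
        κ * Nr ^ (-(1 + 2 * δ)) ≤ cov ∧ 0 < Nr ∧ Nr ≤ 2 ^ 10 * R := by
    by_cases h16 : 16 ∣ a * b * c
    · -- Serre's normalisation and the model (12.18), `u = 2`
      obtain ⟨A, B, hAB, hA4, hB, hprod, hquad⟩ := exists_arrangement h h16
      have h0 : A * B * (A + B) ≠ 0 := by
        rw [← Int.natAbs_ne_zero, hprod]; exact habc0
      have h4 : 4 ∣ B - A - 1 := by
        have : B - A - 1 = B - (A + 1) := by ring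
        rw [this]; exact dvd_sub (dvd_trans (by norm_num) hB) hA4
      have h16' : 16 ∣ A * B := dvd_mul_of_dvd_right hB _
      haveI := isElliptic_freyCurve h0
      set Cv : VariableChange ℚ := ⟨Units.mk0 (2 : ℚ) two_ne_zero, 0, 1, 0⟩ with hCv
      have hCW : Cv • freyCurve A B = (freyIntModel₂ A B).baseChange ℚ :=
        smul_freyCurve_eq_baseChange_freyIntModel₂ h4 h16'
      have hu : 1 ≤ ‖((Cv.u : ℚ) : ℂ)‖ := by simp [hCv]
      obtain ⟨cov, cov', hcov, hc₄, hcc, hlow⟩ := estimates_of_frey_pair hAB h0 (freyIntModel₂ A B)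
        (isMinimalAt_freyIntModel₂ hAB hA4 hB) (isElliptic_freyIntModel₂ h0 h4 h16') Cv hCW hu
        hC₀ hPc hA₀
      -- the conductor: `N_E = cond (12.18) ∣ rad (AB(A+B)) = rad (abc)`
      have hcond : (freyCurve A B).conductorNorm ℤ =
          ((freyIntModel₂ A B).baseChange ℚ).conductorNorm ℤ := by
        have hinv := conductor_smul ℤ (freyCurve A B) (fun v ↦ ordMinimalDiscriminant_smul_holds v _)
          (fun v ↦ kodairaSymbol_smul_holds _) Cv
        unfold conductorNorm
        rw [← hinv, hCW]
      have hdvd : (freyCurve A B).conductorNorm ℤ ∣ DiophantineGeometry.rad a b c := by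
        rw [hcond, DiophantineGeometry.rad_def, ← hprod]
        exact conductorNorm_freyIntModel₂_dvd hAB h0 hA4 hB
      have hNle : (((freyCurve A B).conductorNorm ℤ : ℕ) : ℝ) ≤ 2 ^ 10 * R := by
        have h1 : (((freyCurve A B).conductorNorm ℤ : ℕ) : ℝ) ≤ R := by
          rw [hRdef]; exact_mod_cast Nat.le_of_dvd hRpos hdvd
        exact h1.trans (le_mul_of_one_le_left (zero_le_one.trans hR) (by norm_num))
      have hNpos : (0 : ℝ) < (((freyCurve A B).conductorNorm ℤ : ℕ) : ℝ) := by
        exact_mod_cast conductorNorm_pos_holds (freyCurve A B)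
      -- `c² ≤ 2 c₄'`, `c₄' = A² + AB + B² = (a² + b² + c²)/2`
      have hcc4 : (c : ℝ) ^ 2 ≤ 2 * |((freyIntModel₂ A B).c₄ : ℝ)| := by
        rw [freyIntModel₂_c₄ h4 h16']
        have hq : (0 : ℤ) ≤ A ^ 2 + A * B + B ^ 2 := by
          nlinarith [sq_nonneg (A + B), sq_nonneg A, sq_nonneg B]
        have hz : ((c : ℕ) : ℤ) ^ 2 ≤ 2 * |A ^ 2 + A * B + B ^ 2| := by
          rw [abs_of_nonneg hq, hquad]; nlinarith [sq_nonneg (a : ℤ), sq_nonneg (b : ℤ)]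
        have hzr : (((c : ℕ) : ℤ) : ℝ) ^ 2 ≤ 2 * |((A ^ 2 + A * B + B ^ 2 : ℤ) : ℝ)| := by
          exact_mod_cast hz
        simpa using hzr
      exact ⟨cov, cov', _, _, hcov, hcc4, hc₄, hcc, hlow, hNpos, hNle⟩
    · -- (12.17) is already minimal, `u = 1`
      have hab : IsCoprime (a : ℤ) (b : ℤ) := Nat.isCoprime_iff_coprime.mpr hcop
      have hPz : (a : ℤ) * b * (a + b) = ((a * b * c : ℕ) : ℤ) := by rw [← habc]; push_cast; ring
      have h0 : (a : ℤ) * b * (a + b) ≠ 0 := by rw [hPz]; exact_mod_cast habc0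
      have h16' : ¬ (16 : ℤ) ∣ (a : ℤ) * b * (a + b) := by
        rw [hPz]; exact_mod_cast mt Int.natCast_dvd_natCast.mp h16
      haveI := isElliptic_freyCurve h0
      have hCW : (1 : VariableChange ℚ) • freyCurve (a : ℤ) (b : ℤ) =
          (freyIntModel (a : ℤ) (b : ℤ)).baseChange ℚ := by
        rw [one_smul, baseChange_freyIntModel]
      have hu : 1 ≤ ‖(((1 : VariableChange ℚ).u : ℚ) : ℂ)‖ := by
        simp [WeierstrassCurve.VariableChange.one_def]
      obtain ⟨cov, cov', hcov, hc₄, hcc, hlow⟩ := estimates_of_frey_pair hab h0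
        (freyIntModel (a : ℤ) (b : ℤ)) (isMinimalAt_freyIntModel hab h0 h16')
        (isElliptic_freyIntModel h0) 1 hCW hu hC₀ hPc hA₀
      have hdvd : (freyCurve (a : ℤ) (b : ℤ)).conductorNorm ℤ ∣
          2 ^ 10 * DiophantineGeometry.rad a b c := by
        have := conductorNorm_freyIntModel_dvd hab h0 h16'
        rwa [baseChange_freyIntModel, hPz, Int.natAbs_natCast, ← DiophantineGeometry.rad_def] at this
      have hNle : (((freyCurve (a : ℤ) (b : ℤ)).conductorNorm ℤ : ℕ) : ℝ) ≤ 2 ^ 10 * R := by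
        rw [hRdef]; exact_mod_cast Nat.le_of_dvd (by positivity) hdvd
      have hNpos : (0 : ℝ) < (((freyCurve (a : ℤ) (b : ℤ)).conductorNorm ℤ : ℕ) : ℝ) := by
        exact_mod_cast conductorNorm_pos_holds (freyCurve (a : ℤ) (b : ℤ))
      have hcc4 : (c : ℝ) ^ 2 ≤ 2 * |((freyIntModel (a : ℤ) (b : ℤ)).c₄ : ℝ)| := by
        rw [freyIntModel_c₄]
        have hq : (0 : ℝ) ≤ (a : ℝ) ^ 2 + a * b + b ^ 2 := by positivity
        have hc' : (c : ℝ) = a + b := by rw [← habc]; push_cast; ring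
        push_cast
        rw [abs_of_nonneg (by positivity), hc']
        nlinarith [hq, sq_nonneg ((a : ℝ) - b)]
      exact ⟨cov, cov', _, _, hcov, hcc4, hc₄, hcc, hlow, hNpos, hNle⟩
  -- bookkeeping
  have h6 := pow_six_le_of_estimates hδ hA hκ hNpos hcovpos hcc4 hc₄ hcc hlow hNR hR
  exact le_of_pow_six_le (Nat.cast_nonneg c) hM hR (exponent_le hδ hδ1 hδε) h6

/-- **Corollary: the form of route `ABC/DefiniteXi`** (`FreyDegreeBound → ABC`): a degree bound
`deg ≤ C N^{2+ε}` for some parametrisation datum of every Frey curve implies the `≤`-form of the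
strong abc-conjecture, given the two analytic facts. (The Manin constant is a non-zero integer,
`maninConstant_ne_zero_holds`, so `deg ≤ C N^{2+ε} ≤ max(C,0) · c² · N^{2+ε}`.)
[cite: MurtyCongruencePrimes1999, Thm. 1 (degree conjecture implies abc) via PastenShimura2024 §3 Rem. 3.3] -/
theorem abcLe_of_freyDegreeBound'
    (hP : murty_petersson_newform_lower_bound)
    (hS : silverman1986_discriminant_c4_covolume)
    (hdeg : ∀ ε : ℝ, 0 < ε → ∃ C : ℝ, ∀ a b : ℤ, IsCoprime a b → a * b * (a + b) ≠ 0 →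
      ∀ (N : ℕ) [NeZero N], (freyCurve a b).conductorNorm ℤ = N →
        ∃ D : ModularParametrizationData (freyCurve a b) N,
          (D.deg : ℝ) ≤ C * (N : ℝ) ^ (2 + ε)) :
    ∀ ε : ℝ, 0 < ε → ∃ C : ℝ, ∀ a b c : ℕ, DiophantineGeometry.IsABCTriple a b c →
      (c : ℝ) ≤ C * ((DiophantineGeometry.rad a b c : ℕ) : ℝ) ^ (1 + ε) := by
  refine abcLe_of_freyDegreeBound hP hS fun ε hε ↦ ?_
  obtain ⟨C, hC⟩ := hdeg ε hε
  refine ⟨max C 0, fun a b hab h0 N _ hN ↦ ?_⟩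
  obtain ⟨D, hD⟩ := hC a b hab h0 N hN
  refine ⟨D, hD.trans ?_⟩
  have hc : (1 : ℝ) ≤ (D.c : ℝ) ^ 2 := by
    have h1 : (1 : ℤ) ≤ D.c ^ 2 := by
      have h0' : D.c ≠ 0 := D.maninConstant_ne_zero_holds
      nlinarith [Int.one_le_abs h0', sq_abs D.c]
    exact_mod_cast h1
  have hN0 : (0 : ℝ) ≤ (N : ℝ) ^ (2 + ε) := by positivity
  calc C * (N : ℝ) ^ (2 + ε) ≤ max C 0 * (N : ℝ) ^ (2 + ε) :=
        mul_le_mul_of_nonneg_right (le_max_left _ _) hN0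
    _ = max C 0 * 1 * (N : ℝ) ^ (2 + ε) := by ring
    _ ≤ max C 0 * (D.c : ℝ) ^ 2 * (N : ℝ) ^ (2 + ε) :=
        mul_le_mul_of_nonneg_right (mul_le_mul_of_nonneg_left hc (le_max_right C 0)) hN0

/-- **`≤`-form ⟹ strict form.** The `≤`-form of the strong abc-conjecture (Bombieri–Gubler,
Conj. 12.2.2: "`c ≤ C(ε) rad(abc)^{1+ε}`", no sign condition on `C(ε)`) implies the strict form with
a positive constant, `∀ ε > 0 ∃ C > 0 ∀` abc triples, `c < C · rad(abc)^{1+ε}` — literally the body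
of the summit statement `ABC` (`Summits/ABC/ABC/Statement.lean`, whose audit records the
equivalence as `ABC_iff_BG`): take `C ↦ max(C, 0) + 1`, using `rad(abc) ≥ 1`. [folklore] -/
theorem abcLt_of_abcLe
    (h : ∀ ε : ℝ, 0 < ε → ∃ C : ℝ, ∀ a b c : ℕ, DiophantineGeometry.IsABCTriple a b c →
      (c : ℝ) ≤ C * ((DiophantineGeometry.rad a b c : ℕ) : ℝ) ^ (1 + ε)) :
    ∀ ε : ℝ, 0 < ε → ∃ C : ℝ, 0 < C ∧ ∀ a b c : ℕ, DiophantineGeometry.IsABCTriple a b c →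
      (c : ℝ) < C * ((DiophantineGeometry.rad a b c : ℕ) : ℝ) ^ (1 + ε) := by
  intro ε hε
  obtain ⟨C, hC⟩ := h ε hε
  refine ⟨max C 0 + 1, by positivity, fun a b c habc ↦ ?_⟩
  have hRpos : 0 < DiophantineGeometry.rad a b c := by
    rw [DiophantineGeometry.rad_def]; exact Nat.pos_of_ne_zero radical_ne_zero
  have hR : (0 : ℝ) < ((DiophantineGeometry.rad a b c : ℕ) : ℝ) ^ (1 + ε) :=
    Real.rpow_pos_of_pos (by exact_mod_cast hRpos) _
  calc (c : ℝ) ≤ C * ((DiophantineGeometry.rad a b c : ℕ) : ℝ) ^ (1 + ε) := hC a b c habc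
    _ ≤ max C 0 * ((DiophantineGeometry.rad a b c : ℕ) : ℝ) ^ (1 + ε) :=
        mul_le_mul_of_nonneg_right (le_max_left _ _) hR.le
    _ < (max C 0 + 1) * ((DiophantineGeometry.rad a b c : ℕ) : ℝ) ^ (1 + ε) := by
        rw [add_mul, one_mul]; exact lt_add_of_pos_right _ hR

/-- **The form consumed by route `ABC/DefiniteXi`** (item `DegreeBoundToABC`, re-typed with the two
named facts as hypotheses): Petersson lower bound → Silverman's covolume inequality →
`FreyDegreeBound` → the summit statement `ABC`, whose body is literally the conclusion below
(`Literature.Abc.ABCConjecture`; close the item by `exact abcLt_of_freyDegreeBound`).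
[cite: MurtyCongruencePrimes1999, Thm. 1 (degree conjecture implies abc) via PastenShimura2024 §3 Rem. 3.3] -/
theorem abcLt_of_freyDegreeBound
    (hP : murty_petersson_newform_lower_bound)
    (hS : silverman1986_discriminant_c4_covolume)
    (hdeg : ∀ ε : ℝ, 0 < ε → ∃ C : ℝ, ∀ a b : ℤ, IsCoprime a b → a * b * (a + b) ≠ 0 →
      ∀ (N : ℕ) [NeZero N], (freyCurve a b).conductorNorm ℤ = N →
        ∃ D : ModularParametrizationData (freyCurve a b) N,
          (D.deg : ℝ) ≤ C * (N : ℝ) ^ (2 + ε)) :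
    ∀ ε : ℝ, 0 < ε → ∃ C : ℝ, 0 < C ∧ ∀ a b c : ℕ, DiophantineGeometry.IsABCTriple a b c →
      (c : ℝ) < C * ((DiophantineGeometry.rad a b c : ℕ) : ℝ) ^ (1 + ε) :=
  abcLt_of_abcLe (abcLe_of_freyDegreeBound' hP hS hdeg)

end Main

end Literature.NumberTheory.EllipticCurves

end
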